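import Summits.NavierStokesRegularity.NavierStokesRegularity.Theorems.LinearLiouvilleSeven.Negative.LinearLiouvilleSevenFalseOfGalileanNontrivial
import Summits.NavierStokesRegularity.NavierStokesRegularity.Theorems.SymmetryModuliCountLinearLiouvilleSevenAnchorGradientCaloric
import Summits.NavierStokesRegularity.NavierStokesRegularity.Theorems.SymmetryModuliCountLinearLiouvilleSevenAnchorAssembly
import Summits.NavierStokesRegularity.NavierStokesRegularity.Theorems.SymmetryModuliCountLinearLiouvilleSevenGalileanModeMomentum
import Summits.NavierStokesRegularity.NavierStokesRegularity.Theorems.SymmetryModuliCountLinearLiouvilleSevenGaugeBounds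
import HarnessLib

/-!
# `LinearLiouvilleSeven ↔ TypeIAncientLiouville` (item stmt-NavierStokesRegularity-4054)

Route `SymmetryModuliCount`, sub-problem `NavierStokesRegularity`. The support item
`LinearLiouvilleSeven` (LL7: about every `u ∈ A_C`, any seven tempered classical solutions of the
linearised Navier–Stokes system are dependent modulo slice-wise constants) is EQUIVALENT to the
route TARGET `X = TypeIAncientLiouville` (item stmt-NavierStokesRegularity-4050: every element of
the Oseen-gauge Type-I ancient mild class `A_C` vanishes), kernel-checked in both directions with
no hypothesis left:

* `temperedStokesSliceConstant_holds`, `atZero_holds` — the `u = 0` ANCHOR (tempered classical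
  ancient Stokes solutions on `(−∞, 0) × ℝ³` are slice-wise constant; `stub_anchorAssembly` fed with
  `stub_anchorGradientCaloric`), so `AtZero` of `Theorems/LinearLiouvilleSeven/Negative/NormalForm`
  HOLDS;
* `linearLiouvilleSeven_of_typeIAncientLiouville : X → LL7` (under `X` the linearised operator
  about any `u ∈ A_C` is the Stokes operator on `t < 0`);
* `galileanAdmissible_of_inClassA` — every `u ∈ A_C` admits the modulated Galilean Jacobi fields
  `φ′e − φ∂ₑu` as tempered linearised solutions (gauge pair `exists_gaugePair_of_typeI` = Prop B1
  of the line `galilean-collapse`, now a theorem, fed into the landed stubs B2a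
  `stub_galileanModeRegular` and B2b `stub_galileanModeMomentum`);
* `typeIAncientLiouville_of_linearLiouvilleSeven : LL7 → X` (a nonzero admissible element of
  `A_C` kills LL7: `linearLiouvilleSeven_false_of_galileanNontrivial`, cdisprove seat, p74875);
* `linearLiouvilleSeven_iff_typeIAncientLiouville : LL7 ↔ X`.

So the item is exactly the route target in linear costume: it closes the moment `X` does (by
`linearLiouvilleSeven_of_typeIAncientLiouville`) and not before; conversely any proof of LL7 is a
proof of `X`, the KNSS Liouville conjecture for Type-I ancient mild solutions.

## References

* G. Koch, N. Nadirashvili, G. Seregin, V. Šverák, Acta Math. 203 (2009), §1, Prop. 4.1 [KNSS2009].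
* Cruxes/LinearLiouvilleSeven/Lines/galilean-collapse.lean (the line), Disproof.lean §1, §4.
-/

noncomputable section

set_option linter.dupNamespace false -- tree namespace `Summit.<S>.<S>.Theorems` (summit = sub-problem) trips the core linter under standalone elaboration; the lakefile sets it weakly

open Set Function
open scoped Laplacian ContDiff Topology RealInnerProductSpace BigOperators

namespace Summit.NavierStokesRegularity.NavierStokesRegularity.Theorems

open Literature.Analysis.FluidPDE
open Summit.NavierStokesRegularity.NavierStokesRegularity.Theses.SymmetryModuliCount
open Summit.NavierStokesRegularity.NavierStokesRegularity.Theorems.LinearLiouvilleSeven.Negative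

/-! ### The anchor holds: `X → LL7` -/

/-- **The anchor holds**: every tempered classical ancient STOKES solution on `(−∞, 0) × ℝ³`
(= tempered linearised solution about the zero background) is spatially constant on every slice
(`stub_anchorAssembly` fed with `stub_anchorGradientCaloric`; the convective terms about `u = 0`
vanish identically). -/
theorem temperedStokesSliceConstant_holds : TemperedStokesSliceConstant := by
  intro v q hvq t ht
  obtain ⟨hv, hq, hK, hdiv, heq⟩ := (isTemperedLinearisedNSSolution_iff 0 v q).1 hvq
  refine stub_anchorAssembly stub_anchorGradientCaloric v q hv hq hK hdiv (fun s hs x => ?_) t ht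
  have e := heq s hs x
  simpa [convect] using e

/-- **`AtZero` holds**: the `u = 0` instance of `LinearLiouvilleSeven` — any seven tempered
ancient Stokes solutions are dependent modulo slice-wise constants. -/
theorem atZero_holds : AtZero :=
  atZero_of_temperedStokesSliceConstant temperedStokesSliceConstant_holds

/-- **The route target implies the item, unconditionally**:
`TypeIAncientLiouville → LinearLiouvilleSeven`. Under `X` every `u ∈ A_C` vanishes on `t < 0`, so
the linearised system about `u` is the Stokes system there and the anchor applies. -/
theorem linearLiouvilleSeven_of_typeIAncientLiouville (hX : TypeIAncientLiouville) :
    LinearLiouvilleSeven := by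
  by_contra h
  exact not_typeIAncientLiouville_of_not_linearLiouvilleSeven atZero_holds h hX

/-! ### Galilean admissibility of `A_C`: `LL7 → X` -/

/-- **Every element of `A_C` admits the modulated Galilean Jacobi fields** as tempered classical
linearised solutions: `GalileanAdmissible u` for `u ∈ A_C`. The gauge pair of
`exists_gaugePair_of_typeI` (a jointly smooth pressure on `t < 0` with `‖∇u‖ ≤ C₁/(−t)`,
`‖∇p‖ ≤ C₃/√(−t)³`) feeds the landed stubs B2a (`stub_galileanModeRegular`: smoothness, tempered
growth, incompressibility of `φ′e − φ∂ₑu`, `−φ″⟪e,x⟫ − φ∂ₑp`) and B2b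
(`stub_galileanModeMomentum`: the Galilean Jacobi identity). -/
theorem galileanAdmissible_of_inClassA {C : ℝ} {u : ℝ → E3 → E3} (hu : InClassA C u) :
    GalileanAdmissible u := by
  have hu' : IsTypeIAncientMild C u := isTypeIAncientMild_iff.2 hu
  obtain ⟨p, C₁, C₃, hp, hNS, hC₁, hC₃⟩ := exists_gaugePair_of_typeI hu'
  intro e φ hφ
  obtain ⟨hφs, M, hM⟩ := hφ
  have hM' : ∀ t < 0, |φ t| ≤ M ∧ Real.sqrt (-t) * |deriv φ t| ≤ M ∧
      Real.sqrt (-t) ^ 3 * |iteratedDeriv 2 φ t| ≤ M := by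
    intro t ht
    obtain ⟨h1, h2, h3⟩ := hM t ht
    refine ⟨h1, h2, ?_⟩
    rwa [iteratedDeriv_succ, iteratedDeriv_one]
  obtain ⟨h1, h2, h3, h4⟩ := stub_galileanModeRegular u p φ e C₁ C₃ M hu'.contDiffOn hp
    (fun t ht => hu'.isDivFree ht) hC₁ hC₃ hφs hM'
  have h5 := stub_galileanModeMomentum u p φ e hu'.contDiffOn hp hNS hφs
  exact ⟨fun t x => -(iteratedDeriv 2 φ t * ⟪e, x⟫) - φ t * fderiv ℝ (p t) x e,
    (isTemperedLinearisedNSSolution_iff u _ _).2 ⟨h1, h2, h3, h4, h5⟩⟩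

/-- **`LinearLiouvilleSeven → TypeIAncientLiouville`, unconditionally** (the collapse of the
line `galilean-collapse` with its gauge hypothesis B1 discharged): a nonzero element of `A_C`
carries seven independent modulated Galilean modes defeating the slice-constant quotient
(`linearLiouvilleSeven_false_of_galileanNontrivial`). NOTE: this is an implication FROM the
item, not a proof of the route target. -/
theorem typeIAncientLiouville_of_linearLiouvilleSeven (hL : LinearLiouvilleSeven) :
    TypeIAncientLiouville := by
  intro C u hu t ht x
  by_contra hx
  exact linearLiouvilleSeven_false_of_galileanNontrivial
    ⟨C, u, hu, galileanAdmissible_of_inClassA hu, t, ht, x, hx⟩ hL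

/-- **`LL7 ↔ X`**: the support item `LinearLiouvilleSeven` is equivalent to the route target
`TypeIAncientLiouville` (item stmt-NavierStokesRegularity-4050, the KNSS Liouville conjecture for
Type-I ancient mild solutions, open). -/
theorem linearLiouvilleSeven_iff_typeIAncientLiouville :
    LinearLiouvilleSeven ↔ TypeIAncientLiouville :=
  ⟨typeIAncientLiouville_of_linearLiouvilleSeven, linearLiouvilleSeven_of_typeIAncientLiouville⟩

/-- **Registered stub `stub_linearLiouvilleSevenIffTarget` of item stmt-NavierStokesRegularity-4054**,
in its registered form: the item is equivalent to the route target. -/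
theorem stub_linearLiouvilleSevenIffTarget :
    Summit.NavierStokesRegularity.NavierStokesRegularity.Theses.SymmetryModuliCount.LinearLiouvilleSeven ↔
      Summit.NavierStokesRegularity.NavierStokesRegularity.Theses.SymmetryModuliCount.TypeIAncientLiouville :=
  linearLiouvilleSeven_iff_typeIAncientLiouville

/-! ### The hold hypothesis `H = GalileanNontrivial` is exactly `¬ X` -/

/-- **`H ↔ ¬X`**: the hypothesis `GalileanNontrivial` of the held negative lemma
`linearLiouvilleSeven_false_of_galileanNontrivial` (p74875; the item's hold names it as the object
to construct) is EQUIVALENT to the failure of the route target `TypeIAncientLiouville`. By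
`galileanAdmissible_of_inClassA` every element of `A_C` admits the modulated Galilean modes, so `H`
says precisely "some `A_C` has an element that is nonzero somewhere on `t < 0`". Constructing `H`
is therefore the same task as refuting the route target, i.e. exhibiting a nonzero Type-I ancient
mild solution (open, KNSS 2009 §1). -/
theorem galileanNontrivial_iff_not_typeIAncientLiouville :
    GalileanNontrivial ↔ ¬ TypeIAncientLiouville := by
  constructor
  · rintro ⟨C, u, hu, -, t, ht, x, hx⟩ hX
    exact hx (hX C u hu t ht x)
  · intro hX
    by_contra hH
    refine hX fun C u hu t ht x => ?_
    by_contra hx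
    exact hH ⟨C, u, hu, galileanAdmissible_of_inClassA hu, t, ht, x, hx⟩

/-- **`¬LL7 ↔ H`**: the item fails exactly when the hold hypothesis holds (`LL7 ↔ X` combined with
`H ↔ ¬X`); together with `linearLiouvilleSeven_iff_typeIAncientLiouville` this pins the item, its
negation and its hold to the single open question `X` (item stmt-NavierStokesRegularity-4050). -/
theorem not_linearLiouvilleSeven_iff_galileanNontrivial :
    ¬ LinearLiouvilleSeven ↔ GalileanNontrivial := by
  rw [galileanNontrivial_iff_not_typeIAncientLiouville, linearLiouvilleSeven_iff_typeIAncientLiouville]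

end Summit.NavierStokesRegularity.NavierStokesRegularity.Theorems

end
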